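import Summits.QuantumFields.YangMills.Theorems.ColdStartUniversalityLatticeLangevinFunctionalCLTFdd
import Summits.QuantumFields.YangMills.Theorems.ColdStartUniversalityLatticeLangevinSplice
import Mathlib.Probability.Distributions.Gaussian.CharFun
import Mathlib.Analysis.CStarAlgebra.Matrix
import HarnessLib

/-!
# Route `ColdStartUniversality` (fixed-cut-off SZZ dynamics, sampler package): ★★★ FUNCTIONAL CLT — the finite-dimensional distributions of the
# partial-sum process converge to those of `σ(G)·W`, `W` a standard BROWNIAN MOTION (covariance `σ² min(s,t)`)

Helper file (seat `ym-line-csu-p1`, g35; `--supports stmt-QuantumFields-24809`).  File 102d gave the convergence of the window INCREMENTS to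
independent Gaussians; here the VALUES of the rescaled partial-sum process are treated: for every strong solution `U` of the SU(2) SZZ dynamics from a
deterministic start, every continuous `|G| ≤ 1` and all times `0 = s₀ ≤ s₁ ≤ ⋯ ≤ s_m ≤ 1`, along every `T_n → ∞`,

  `( T_n^(−1/2) ∫_(0, sᵢ₊₁T_n] Ĝ(U_r) dr )_(i<m)  ⇒  N(0, (σ²(G)·min(sᵢ₊₁, sⱼ₊₁))ᵢⱼ) = law of (σW_(s₁), …, σW_(s_m))`   (★★★ `functionalCLT_fdd_values`),

and the limiting covariance matrix is positive semidefinite.  Ingredients: `map_toEuclideanCLM_multivariateGaussian` — the image of `N(0,D)` under the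
linear map of a matrix `A` is `N(0, ADAᴴ)` (Mathlib's `IsGaussian.ext`, `covarianceBilin_map`); the cumulative-sum matrix applied to the increments
(continuous mapping); the telescoping `ADAᵀ = σ²(min(sᵢ₊₁,sⱼ₊₁))`; regular flow + pathwise uniqueness.  Tightness in `C[0,1]` is not addressed.
THEOREMS ONLY, no definition, no sorry; [folklore].
HONEST FRAMING: fixed cut-off; `σ²(G)` depends on `L, β'`; `UniformColdStartMixing` (24809) is NOT restated; no crux, rung or summit statement is
proved; the Yang–Mills mass gap is NOT proved.
-/

set_option autoImplicit false

noncomputable section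

namespace Summit.QuantumFields.YangMills.Theorems.ColdStartUniversality

open MeasureTheory ProbabilityTheory Filter Topology Set Matrix
open scoped NNReal ENNReal BigOperators InnerProductSpace
open Literature Literature.Probability.Process Literature.MathematicalPhysics.QuantumFieldTheory
open Literature.MathematicalPhysics.QuantumLattice (fundamentalRep fundamentalLatticeRep continuous_fundamentalRep)

/-! ## §1. Linear images of multivariate Gaussians -/

/-- The image of the centred multivariate Gaussian `N(0, D)` (`D` positive semidefinite) under the linear map of a matrix `A` is `N(0, A D Aᴴ)`.
[folklore] -/
theorem map_toEuclideanCLM_multivariateGaussian {ι : Type} [Fintype ι] [DecidableEq ι] {D : Matrix ι ι ℝ} (hD : D.PosSemidef)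
    (A : Matrix ι ι ℝ) :
    (multivariateGaussian 0 D).map (Matrix.toEuclideanCLM (n := ι) (𝕜 := ℝ) A) = multivariateGaussian 0 (A * D * Aᴴ) := by
  have hK : (A * D * Aᴴ).PosSemidef := hD.mul_mul_conjTranspose_same A
  set Lc := Matrix.toEuclideanCLM (n := ι) (𝕜 := ℝ) A with hLc
  have hadj : Lc.adjoint = Matrix.toEuclideanCLM (n := ι) (𝕜 := ℝ) Aᴴ := by
    rw [← ContinuousLinearMap.star_eq_adjoint, hLc, ← map_star, Matrix.star_eq_conjTranspose]
  have hid : Integrable (fun x : EuclideanSpace ℝ ι => x) (multivariateGaussian 0 D) := IsGaussian.integrable_id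
  refine IsGaussian.ext ?_ ?_
  · rw [integral_map (by fun_prop) (by fun_prop)]
    change ∫ x, Lc x ∂(multivariateGaussian 0 D) = ∫ x, x ∂(multivariateGaussian 0 (A * D * Aᴴ))
    rw [ContinuousLinearMap.integral_comp_comm Lc hid, integral_id_multivariateGaussian, integral_id_multivariateGaussian, map_zero]
  · ext u v
    rw [covarianceBilin_map IsGaussian.memLp_two_id, covarianceBilin_multivariateGaussian hD, covarianceBilin_multivariateGaussian hK, hadj]
    simp only [Matrix.ofLp_toEuclideanCLM, Matrix.conjTranspose_eq_transpose_of_trivial]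
    rw [Matrix.mulVec_transpose A u.ofLp, ← Matrix.dotProduct_mulVec, Matrix.mulVec_mulVec, Matrix.mulVec_mulVec]

/-! ## §2. Convergence of the finite-dimensional distributions to Brownian motion -/

variable {L : ℕ} [NeZero L]

/-- ★★★ **Functional CLT, values of the partial-sum process.**  Along every `T_n → ∞` the vector `(T_n^(−1/2)∫_(0,sᵢ₊₁T_n] Ĝ(U_r)dr)_(i<m)`
converges in distribution to the centred Gaussian with covariance `σ²·min(sᵢ₊₁, sⱼ₊₁)` — the finite-dimensional distributions of `σ·W` for a
standard Brownian motion `W` (every strong solution from a deterministic start; fixed cut-off). [folklore] -/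
theorem functionalCLT_fdd_values (L : ℕ) [NeZero L] (β' : ℝ)
    (κ : ℝ≥0 → Kernel (GaugeConfig 3 L (Matrix.specialUnitaryGroup (Fin 2) ℂ))
      (GaugeConfig 3 L (Matrix.specialUnitaryGroup (Fin 2) ℂ))) [∀ t, IsMarkovKernel (κ t)]
    (hreal : ∀ (t : ℝ≥0) (x : GaugeConfig 3 L (Matrix.specialUnitaryGroup (Fin 2) ℂ))
        (Ω : Type) [MeasurableSpace Ω] (P : Measure Ω) [IsProbabilityMeasure P]
        (W : ℝ≥0 → Ω → (Edge 3 L × NoiseIdx 2 → ℝ)) (hW : IsFlatBrownian W P)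
        (U : ℝ≥0 → Ω → GaugeConfig 3 L (Matrix.specialUnitaryGroup (Fin 2) ℂ)),
        (∀ ω, U 0 ω = x) →
        (latticeLangevinDynamics (fundamentalLatticeRep 2) β').IsSolution (fundamentalRep (Fin 2))
          hW.natFiltration P W U →
        κ t x = P.map (U t))
    (x : GaugeConfig 3 L (Matrix.specialUnitaryGroup (Fin 2) ℂ))
    {Ω : Type} [MeasurableSpace Ω] {P : Measure Ω} [IsProbabilityMeasure P]
    {W : ℝ≥0 → Ω → (Edge 3 L × NoiseIdx 2 → ℝ)} (hW : IsFlatBrownian W P)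
    {U : ℝ≥0 → Ω → GaugeConfig 3 L (Matrix.specialUnitaryGroup (Fin 2) ℂ)} (hU0 : ∀ ω, U 0 ω = x)
    (hU : (latticeLangevinDynamics (fundamentalLatticeRep 2) β').IsSolution (fundamentalRep (Fin 2)) hW.natFiltration P W U)
    {G : GaugeConfig 3 L (Matrix.specialUnitaryGroup (Fin 2) ℂ) → ℝ} (hGc : Continuous G) (hG1 : ∀ z, |G z| ≤ 1)
    {σ2 : ℝ} (hσ2 : σ2 = 2 * ∫ t in Ioi (0 : ℝ),
        (∫ y, (G y - ∫ z, G z ∂(wilsonMeasure (d := 3) (L := L) (fundamentalRep (Fin 2)) β')) *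
          (∫ z, (G z - ∫ z', G z' ∂(wilsonMeasure (d := 3) (L := L) (fundamentalRep (Fin 2)) β')) ∂(κ t.toNNReal y))
          ∂(wilsonMeasure (d := 3) (L := L) (fundamentalRep (Fin 2)) β')))
    {m : ℕ} (s : ℕ → ℝ) (hs0 : s 0 = 0) (hsmono : Monotone s) (hs1 : s m ≤ 1) :
    Matrix.PosSemidef (fun i j : Fin m => σ2 * s (min (i : ℕ) (j : ℕ) + 1) : Matrix (Fin m) (Fin m) ℝ) ∧
    ∀ (Ω' : Type) [MeasurableSpace Ω'] (P' : Measure Ω') [IsProbabilityMeasure P'] (Y : Ω' → EuclideanSpace ℝ (Fin m)),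
      HasLaw Y (multivariateGaussian 0 (fun i j : Fin m => σ2 * s (min (i : ℕ) (j : ℕ) + 1))) P' →
      ∀ (Tn : ℕ → ℝ), Tendsto Tn atTop atTop →
      TendstoInDistribution (fun (n : ℕ) ω => (WithLp.toLp 2 fun i : Fin m => (Real.sqrt (Tn n))⁻¹ *
        ∫ r in Ioc (0 : ℝ) (s ((i : ℕ) + 1) * Tn n),
          (G (U r.toNNReal ω) - ∫ z, G z ∂(wilsonMeasure (d := 3) (L := L) (fundamentalRep (Fin 2)) β')) : EuclideanSpace ℝ (Fin m)))
        atTop Y (fun _ => P) P' := by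
  classical
  haveI := secondCountableTopology_su2
  haveI := borelSpace_config L
  set μ : Measure (GaugeConfig 3 L (Matrix.specialUnitaryGroup (Fin 2) ℂ)) :=
    wilsonMeasure (d := 3) (L := L) (fundamentalRep (Fin 2)) β' with hμ
  set mG : ℝ := ∫ z, G z ∂μ with hmG
  have hGhm : Measurable fun z => G z - mG := hGc.measurable.sub measurable_const
  have hmG1 : |mG| ≤ 1 := by
    haveI : IsProbabilityMeasure μ :=
      isProbabilityMeasure_wilsonMeasure (d := 3) (L := L) (fundamentalRep (Fin 2)) (continuous_fundamentalRep (Fin 2)) β'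
    have hh := norm_integral_le_of_norm_le_const (μ := μ) (f := G) (C := 1)
      (Eventually.of_forall fun z => by simpa [Real.norm_eq_abs] using hG1 z)
    simpa [Real.norm_eq_abs] using hh
  have hGhb : ∀ z, |G z - mG| ≤ 2 := fun z => (abs_sub _ _).trans (by linarith [hG1 z, hmG1])
  have hs_nonneg : ∀ i, 0 ≤ s i := fun i => by rw [← hs0]; exact hsmono (Nat.zero_le i)
  /- ### 1. The increments (file 102d) along the regular flow, with the canonical Gaussian limit -/
  obtain ⟨V, -, hV, hVprog, -, -, -⟩ := exists_regularFlow L β' hW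
  have hprog : ∀ i : ℝ≥0, Measurable[@Prod.instMeasurableSpace (Set.Iic i) Ω inferInstance (hW.natFiltration i)]
      (fun q : Set.Iic i × Ω => V x q.1 q.2) := fun i =>
    (hVprog i).comp (measurable_fst.prodMk (measurable_const.prodMk measurable_snd))
  have hae : ∀ᵐ ω ∂P, ∀ t, U t ω = V x t ω := latticeLangevin_pathwise_unique hW β' x hU0 (hV x).1 hU (hV x).2
  have hpathm : Measurable fun p : Ω × ℝ => V x p.2.toNNReal p.1 :=
    measurable_uncurry_of_prog (Z := V x) (fun n : ℕ => hW.natFiltration n) (fun n => hW.natFiltration.le n) (fun n => hprog n)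
  have hpath : ∀ ω (y : ℝ), IntegrableOn (fun r : ℝ => G (V x r.toNNReal ω) - mG) (Ioc (0 : ℝ) y) volume := fun ω y =>
    (integrableOn_const (C := (2 : ℝ)) (hs := measure_Ioc_lt_top.ne)).mono'
      ((hGhm.comp (hpathm.comp (measurable_const.prodMk measurable_id))).aestronglyMeasurable)
      (Eventually.of_forall fun r => by rw [Real.norm_eq_abs]; exact hGhb _)
  obtain ⟨hPSD, hfdd⟩ := functionalCLT_fdd L β' κ hreal x hW (hV x).1 (hV x).2 hGc hG1 hσ2 s hs0 hsmono hs1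
  set D : Matrix (Fin m) (Fin m) ℝ := Matrix.diagonal fun i : Fin m => σ2 * (s ((i : ℕ) + 1) - s i) with hD
  set A : Matrix (Fin m) (Fin m) ℝ := fun i j => if (j : ℕ) ≤ (i : ℕ) then 1 else 0 with hA
  set Lc := Matrix.toEuclideanCLM (n := Fin m) (𝕜 := ℝ) A with hLc
  -- the covariance of the values
  have hK : A * D * Aᴴ = (fun i j : Fin m => σ2 * s (min (i : ℕ) (j : ℕ) + 1)) := by
    ext i j
    rw [Matrix.conjTranspose_eq_transpose_of_trivial, Matrix.mul_apply]
    simp only [Matrix.transpose_apply, hD, Matrix.mul_diagonal, hA]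
    have hterm : ∀ l : Fin m, (if (l : ℕ) ≤ (i : ℕ) then (1 : ℝ) else 0) * (σ2 * (s ((l : ℕ) + 1) - s l)) *
        (if (l : ℕ) ≤ (j : ℕ) then (1 : ℝ) else 0) = if (l : ℕ) ≤ min (i : ℕ) (j : ℕ) then σ2 * (s ((l : ℕ) + 1) - s l) else 0 := by
      intro l
      by_cases h1 : (l : ℕ) ≤ (i : ℕ) <;> by_cases h2 : (l : ℕ) ≤ (j : ℕ) <;> simp [h1, h2]
    rw [Finset.sum_congr rfl fun l _ => hterm l,
      Fin.sum_univ_eq_sum_range (fun l => if l ≤ min (i : ℕ) (j : ℕ) then σ2 * (s (l + 1) - s l) else 0) m, ← Finset.sum_filter]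
    have hfilt : (Finset.range m).filter (fun l => l ≤ min (i : ℕ) (j : ℕ)) = Finset.range (min (i : ℕ) (j : ℕ) + 1) := by
      ext l
      simp only [Finset.mem_filter, Finset.mem_range]
      have := i.isLt; have := j.isLt
      omega
    rw [hfilt, ← Finset.mul_sum, Finset.sum_range_sub (fun l => s l), hs0, sub_zero]
  have hKpsd : Matrix.PosSemidef (fun i j : Fin m => σ2 * s (min (i : ℕ) (j : ℕ) + 1) : Matrix (Fin m) (Fin m) ℝ) := by
    rw [← hK]; exact hPSD.mul_mul_conjTranspose_same A
  refine ⟨hKpsd, fun Ω' _ P' _ Y hY Tn hTn => ?_⟩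
  have hinc := hfdd (EuclideanSpace ℝ (Fin m)) (multivariateGaussian 0 D) id HasLaw.id Tn hTn
  have hvals := hinc.continuous_comp Lc.continuous
  /- ### 2. Cumulative sums of the increments are the values (pathwise, along `V`) -/
  obtain ⟨F, hF⟩ : ∃ F : Ω → ℝ → ℝ, ∀ ω y, F ω y = ∫ r in Ioc (0 : ℝ) y, (G (V x r.toNNReal ω) - mG) := ⟨_, fun _ _ => rfl⟩
  have hFdiff : ∀ ω (lo hi : ℝ), 0 ≤ lo → lo ≤ hi → ∫ r in Ioc lo hi, (G (V x r.toNNReal ω) - mG) = F ω hi - F ω lo := by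
    intro ω lo hi hlo hle
    rw [hF, hF, ← Ioc_union_Ioc_eq_Ioc hlo hle, setIntegral_union (Ioc_disjoint_Ioc_of_le le_rfl) measurableSet_Ioc
      ((hpath ω hi).mono_set (Ioc_subset_Ioc_right hle)) ((hpath ω hi).mono_set (Ioc_subset_Ioc_left hlo))]
    ring
  have hF0 : ∀ ω, F ω 0 = 0 := fun ω => by rw [hF, Ioc_self, Measure.restrict_empty, integral_zero_measure]
  have hident : ∀ n ω, Lc (WithLp.toLp 2 fun i : Fin m => (Real.sqrt (Tn n))⁻¹ *
      ∫ r in Ioc (s i * Tn n) (s ((i : ℕ) + 1) * Tn n), (G (V x r.toNNReal ω) - mG)) =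
      WithLp.toLp 2 fun i : Fin m => (Real.sqrt (Tn n))⁻¹ * ∫ r in Ioc (0 : ℝ) (s ((i : ℕ) + 1) * Tn n), (G (V x r.toNNReal ω) - mG) := by
    intro n ω
    rw [hLc, Matrix.toEuclideanCLM_toLp]
    congr 1
    funext i
    simp only [Matrix.mulVec, dotProduct, hA, ite_mul, one_mul, zero_mul]
    rw [Fin.sum_univ_eq_sum_range (fun j => if j ≤ (i : ℕ) then (Real.sqrt (Tn n))⁻¹ *
      ∫ r in Ioc (s j * Tn n) (s (j + 1) * Tn n), (G (V x r.toNNReal ω) - mG) else 0) m, ← Finset.sum_filter]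
    have hfilt : (Finset.range m).filter (fun j => j ≤ (i : ℕ)) = Finset.range ((i : ℕ) + 1) := by
      ext j
      simp only [Finset.mem_filter, Finset.mem_range]
      have := i.isLt
      omega
    rw [hfilt, ← Finset.mul_sum]
    congr 1
    rcases le_or_gt (Tn n) 0 with hT | hT
    · -- all windows are empty
      have hem : ∀ j : ℕ, Ioc (s j * Tn n) (s (j + 1) * Tn n) = ∅ := fun j =>
        Ioc_eq_empty (not_lt.2 (mul_le_mul_of_nonpos_right (hsmono (Nat.le_succ j)) hT))
      have hem' : Ioc (0 : ℝ) (s ((i : ℕ) + 1) * Tn n) = ∅ :=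
        Ioc_eq_empty (not_lt.2 (mul_nonpos_of_nonneg_of_nonpos (hs_nonneg _) hT))
      simp only [hem, hem', Measure.restrict_empty, integral_zero_measure, Finset.sum_const_zero]
    · rw [Finset.sum_congr rfl fun j _ => hFdiff ω (s j * Tn n) (s (j + 1) * Tn n) (mul_nonneg (hs_nonneg j) hT.le)
        (mul_le_mul_of_nonneg_right (hsmono (Nat.le_succ j)) hT.le), Finset.sum_range_sub (fun j => F ω (s j * Tn n)), hs0, zero_mul, hF0,
        sub_zero, hF]
  have hvalsV : TendstoInDistribution (fun (n : ℕ) ω => (WithLp.toLp 2 fun i : Fin m => (Real.sqrt (Tn n))⁻¹ *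
      ∫ r in Ioc (0 : ℝ) (s ((i : ℕ) + 1) * Tn n), (G (V x r.toNNReal ω) - mG) : EuclideanSpace ℝ (Fin m)))
      atTop (⇑Lc ∘ id) (fun _ => P) (multivariateGaussian 0 D) := by
    refine hvals.congr (fun n => Eventually.of_forall fun ω => ?_) (ae_eq_refl _)
    simp only [Function.comp_apply]
    exact hident n ω
  /- ### 3. The law of the limit and the transfer to `U` -/
  have hlaw : (multivariateGaussian 0 D).map (⇑Lc ∘ id) = multivariateGaussian 0 (fun i j : Fin m => σ2 * s (min (i : ℕ) (j : ℕ) + 1)) := by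
    rw [Function.comp_id, hLc, map_toEuclideanCLM_multivariateGaussian hPSD A, hK]
  have hVres : TendstoInDistribution (fun (n : ℕ) ω => (WithLp.toLp 2 fun i : Fin m => (Real.sqrt (Tn n))⁻¹ *
      ∫ r in Ioc (0 : ℝ) (s ((i : ℕ) + 1) * Tn n), (G (V x r.toNNReal ω) - mG) : EuclideanSpace ℝ (Fin m))) atTop Y (fun _ => P) P' := by
    refine ⟨hvalsV.forall_aemeasurable, hY.aemeasurable, ?_⟩
    convert hvalsV.tendsto using 2
    exact Subtype.ext (by simp only; rw [hY.map_eq, hlaw])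
  refine hVres.congr (fun n => ?_) (ae_eq_refl _)
  filter_upwards [hae] with ω hω
  simp only [hω]

end Summit.QuantumFields.YangMills.Theorems.ColdStartUniversality

end
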